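import Summits.QuantumFields.QCD.Theses.NestedDissectionSea
import Summits.QuantumFields.QCD.Theorems.EarlyCrosserLaw.Negative.LowerPinLoadBearing
import Literature.MathematicalPhysics.QuantumFieldTheory.QCDGoldstoneBound
import Summits.QuantumFields.QCD.Theorems.NestedDissectionSeaLightQuarkCompletionGlue

/-!
# Disproof of `LightQuarkCompletion` (stmt-QuantumFields-18066, route NestedDissectionSea, rank 6) — findings

Standing disprover: cycle 1 `refuter-cdisprove-stmt-QuantumFields-18066-0`, cycle 2 `refuter-cdisprove-stmt-QuantumFields-18066-g2-0`
(2026-08-17).  NO KILL.  Everything below is kernel-checked (rc 0, 0 sorry, standard axioms); prose lives in docstrings.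
Landed extracts (all ACCEPTED, importable): `Theorems/LightQuarkCompletion/Negative/Anatomy.lean` (§1–§3, p136772);
`…/Negative/LineSketchLoadBearing.lean` (§4, §5, §7, J-form of §9; p139458); `…/Negative/PinClash.lean` (§8; p139372);
`…/Negative/SelfImprovement.lean` (§9; p139748); `…/Negative/FlavourRestriction.lean` (§12; p139863);
`…/Negative/BandLowerPin.lean` (§13; p140088).  Only §11 (glue for the lead) lives here alone.

**Anatomy** (§1, `lightQuarkCompletion_iff`, `Iff.rfl` up to the abbreviations `PinPkg` / `Body` / `Concl`): the crux is
`∀ Nf ∈ {2,3}, ∀ reg M₀, HypAt Nf reg M₀ → Concl Nf` and `Concl Nf` does NOT mention `reg`: the crux is the implication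
"(pinned threshold QCD is inhabited at `N_f`) → (zero-threshold-pinned, chiral, all-masses QCD exists at `N_f`)", and
`Concl Nf → QCDOf Nf`; indeed (§9) `Concl` is itself the package at threshold `0`, so the crux is a SELF-IMPROVEMENT statement
(`lightQuarkCompletion_iff_selfImprovement`) implied outright by `Concl 2 ∧ Concl 3` (`lightQuarkCompletion_of_concl`).
**Refutation window** (§2, `not_lightQuarkCompletion_iff`): a disproof must BOTH construct a regularisation carrying the
threshold package (two-sided parity pin above `M₀` + the `QCDOf` body above `M₀` — IsQCDAlong-tied OS data with
`IsNontrivial`/`IsNonGaussian` glue and an honest `HasLatticeMassGap`) AND refute `Concl Nf ⊇ QCDOf Nf`; neither half has a junk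
instance (the only cheaply decidable piece of the pins is Seiler positivity, `P(Re det D_W(μ) < 0) = 0` off `(−8,0)`, which can
only make a LOWER pin FAIL).  **Load-bearing analysis** (§3): of the six hypotheses, THREE ARE IDLE — `HasAsymptoticScaling`
(implied by the body: `body_hasAsymptoticScaling`), `0 ≤ M₀` (monotonicity), and the weak branch `∀ᶠ k, −1 ≤ m_crit k`
(`lightQuarkCompletion_iff_withoutBranch`: the whole package is covariant under the RGI up-shift `m_crit ↦ m_crit + a(M₀+1)/Z_m`,
after which the body's own `IsQCDAlong` branch clause supplies `−1 < m_crit`); the other three (`N_f ∈ {2,3}`, `HasMassScaling`,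
pin, body) cannot be shown load-bearing or idle in Lean because the conclusion is `reg`-free and QCD-hard on both sides.
**Line `Sketch`** (§4, §5, §7, §8; the lead's four stubs): joint sufficiency is the landed glue `lightQuarkCompletion_of_stubs`;
stub J (`stub_jumpLineIsChiral`) ⇔ no uniformly gapped zero-pinned all-masses QCD exists (§9), and it LOSES ITS TRUTH WITHOUT THE
PIN modulo the believed-true, unconstructible `UniformlyGappedBranchThresholdQCD` (§4) — so any proof of J must use the
zero-threshold pin, and `m_crit' → 0` is NOT what excludes the shifted countermodels; stub B2b (`stub_physicalBranch`) is FALSE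
once the body and both LOWER pins are deleted (§5) and stub B2a (`stub_jumpGerm`) is FALSE once the body and the threshold LOWER
pin are deleted (§7) — heavy junk `m_crit ≡ 1` carries every upper pin for free; PIN RIGIDITY holds EXACTLY modulo radius
compatibility `R_lower < 2R_upper` (§8 `pin_clash`, germ confinement / uniqueness corollaries), which no hypothesis supplies.
**Targets** (§13, the lead's stuck B2a goal): the `J = M₀` residual "lower pin THROUGH the band" clashes with any zero-threshold
upper pin of the same regularisation (`bandLowerPin_clash`; all radii ⇒ every radius fails) — FALSE over all threshold packages
modulo one zero-pinned all-radii package: the germ must be located, not postulated at the top of the band.  **Flavour guard** (§12): at `N_f = 0` the conclusion is INCONSISTENT (`not_concl_zero`: one tuple, gapped and gapless), so the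
crux / stub J with `Nf = 2 ∨ Nf = 3` deleted are false modulo inhabitation of the (zero-)pinned quenched package — J must USE
`N_f ≥ 2` in Lean.  **Why it resists** (§6 cycle 1, §10 cycle 2 incl. the literature on the zero-threshold upper pin).  **Lead's question on
B2c** (§11): same-reg `stub_lightBody` is not refutable modulo any believed `H` (Aoki/first-order bands have vanishing RGI width;
the only killer — parity line ≠ chiral line at RGI precision — kills J and `Concl` too, i.e. is the crux's substantive failure
mode); its one formal excess is full-sequence convergence, removable for free: `lightQuarkCompletion_of_stubs_subseqBody` closes
the crux from B2a, B2b, J and B2c weakened to "body along SOME further subsequence".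
-/

noncomputable section

open scoped BigOperators Classical
open MeasureTheory Filter Topology Matrix
open Literature.MathematicalPhysics.QuantumLattice Literature.MathematicalPhysics.QuantumFieldTheory
  Literature.Probability.LatticeModels
open Summit.QuantumFields.QCD.Theses.NestedDissectionSea
open Summit.QuantumFields.QCD.Theorems.CoerciveSeaNegative
open Summit.QuantumFields.QCD.Theorems.EarlyCrosserLawNegative

namespace Summit.QuantumFields.QCD.Cruxes.LightQuarkCompletion.Disproof

variable {Nf : ℕ}

/-! ## §1 Anatomy: verbatim abbreviations and the `reg`-free conclusion -/

/-- **The two-sided parity pin above threshold `M₀`** (hypothesis 5 of the crux at `M₀`, conjunct 4 of its conclusion at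
`0`), VERBATIM over the tree's `PinClause` (lower pin (b)) and `UpperPin` (upper pin (b″)).  Statement abbreviation. -/
def PinPkg (Nf : ℕ) (reg : QCDRegularisation Nf) (M₀ : ℝ) : Prop :=
  ∀ m : Fin Nf → ℝ, (∀ f, M₀ < m f) → ∃ R : ℝ, 0 < R ∧ PinClause Nf reg M₀ m R ∧ UpperPin Nf reg M₀ m R

/-- **The `QCDOf` body above threshold `M₀`** (hypothesis 6 of the crux at `M₀`, last conjunct of its conclusion at `0`),
VERBATIM.  Statement abbreviation. -/
def Body (Nf : ℕ) (reg : QCDRegularisation Nf) (M₀ : ℝ) : Prop :=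
  ∀ m : Fin Nf → ℝ, (∀ f, M₀ < m f) → ∃ (z shift : QCDField Nf → ℕ → ℝ) (T : OSData (QCDField Nf) 4),
    IsQCDAlong (reg.scheme m z shift) T ∧ T.IsNontrivial QCDField.glue ∧ T.IsNonGaussian QCDField.glue ∧
      (∀ f g : Fin Nf, f ≠ g → T.IsNontrivial (QCDField.pseudoRe f g)) ∧
        ∃ Δ > 0, T.HasMassGap Δ ∧ (reg.scheme m z shift).HasLatticeMassGap Δ

/-- **The hypothesis package of the crux at `(reg, M₀)`**, VERBATIM: mass scaling, asymptotic scaling, weak branch,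
`0 ≤ M₀`, the pin above `M₀`, the body above `M₀`.  Statement abbreviation. -/
def HypAt (Nf : ℕ) (reg : QCDRegularisation Nf) (M₀ : ℝ) : Prop :=
  reg.HasMassScaling ∧ (reg.scheme 0 0 0).HasAsymptoticScaling ∧ (∀ᶠ k : ℕ in atTop, -1 ≤ reg.mcrit k) ∧ 0 ≤ M₀ ∧
    PinPkg Nf reg M₀ ∧ Body Nf reg M₀

/-- **The conclusion of the crux at `N_f`**, VERBATIM: some regularisation with both scalings, `m_crit' → 0`, the pin at ZERO
threshold, chiral at zero, and the body at every positive tuple.  It does not mention the hypothesis' `reg`.  Statement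
abbreviation. -/
def Concl (Nf : ℕ) : Prop :=
  ∃ reg' : QCDRegularisation Nf, reg'.HasMassScaling ∧ (reg'.scheme 0 0 0).HasAsymptoticScaling ∧
    Tendsto reg'.mcrit atTop (𝓝 0) ∧ PinPkg Nf reg' 0 ∧ reg'.IsChiralAtZero ∧ Body Nf reg' 0

/-- **The crux IS `∀ Nf ∈ {2,3}, ∀ reg M₀, HypAt → Concl`** (definitional unfolding; certifies the abbreviations are verbatim). -/
theorem lightQuarkCompletion_iff :
    LightQuarkCompletion ↔ ∀ Nf : ℕ, (Nf = 2 ∨ Nf = 3) → ∀ (reg : QCDRegularisation Nf) (M₀ : ℝ),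
      HypAt Nf reg M₀ → Concl Nf := by
  constructor
  · intro h Nf hNf reg M₀ hH
    obtain ⟨hMS, hAS, hbr, hM₀, hpin, hbody⟩ := hH
    exact h Nf hNf reg hMS hAS hbr M₀ hM₀ hpin hbody
  · intro h Nf hNf reg hMS hAS hbr M₀ hM₀ hpin hbody
    exact h Nf hNf reg M₀ ⟨hMS, hAS, hbr, hM₀, hpin, hbody⟩

/-- **The conclusion is `reg`-free**: the crux is the implication "threshold package inhabited → `Concl`". -/
theorem lightQuarkCompletion_iff_exists :
    LightQuarkCompletion ↔ ∀ Nf : ℕ, (Nf = 2 ∨ Nf = 3) →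
      (∃ (reg : QCDRegularisation Nf) (M₀ : ℝ), HypAt Nf reg M₀) → Concl Nf := by
  rw [lightQuarkCompletion_iff]
  constructor
  · rintro h Nf hNf ⟨reg, M₀, hH⟩
    exact h Nf hNf reg M₀ hH
  · intro h Nf hNf reg M₀ hH
    exact h Nf hNf ⟨reg, M₀, hH⟩

/-- **`Concl Nf` implies the summit conjunct `QCDOf Nf`** (forget asymptotic scaling, `m_crit' → 0` and the pin). -/
theorem concl_qcdOf (h : Concl Nf) : QCDOf Nf := by
  obtain ⟨reg', hMS, -, -, -, hχ, hbody⟩ := h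
  exact ⟨reg', hMS, hχ, hbody⟩

/-! ## §2 The refutation window -/

/-- **THE WINDOW.**  `LightQuarkCompletion` fails iff at `N_f = 2` or `3` the threshold package is INHABITED (a construction of
pinned threshold QCD: both scalings, weak branch, two-sided parity pin and `QCDOf` body above some `M₀ ≥ 0`) and `Concl N_f`
FAILS (no zero-threshold-pinned chiral regularisation carries the body at all positive masses).  Neither half has a junk
instance: the body needs IsQCDAlong-tied OS data with non-trivial non-Gaussian glue and an honest uniform lattice gap; a lower
pin needs a phase-quenched sign probability `≥ 1/4`, which no closed-form evaluation in the tree provides (Seiler positivity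
only EMPTIES the event off `(−8, 0)`); and `¬ Concl` contains `¬`(pinned chiral QCD). -/
theorem not_lightQuarkCompletion_iff :
    ¬ LightQuarkCompletion ↔ ∃ Nf : ℕ, (Nf = 2 ∨ Nf = 3) ∧
      (∃ (reg : QCDRegularisation Nf) (M₀ : ℝ), HypAt Nf reg M₀) ∧ ¬ Concl Nf := by
  rw [lightQuarkCompletion_iff_exists]
  push Not
  rfl

/-- **A disproof through the summit conjunct**: inhabiting the threshold package at `N_f` and refuting `QCDOf N_f` refutes the
crux (the converse fails: `Concl` is stronger than `QCDOf`). -/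
theorem not_lightQuarkCompletion_of_not_qcdOf (hNf : Nf = 2 ∨ Nf = 3)
    (hpkg : ∃ (reg : QCDRegularisation Nf) (M₀ : ℝ), HypAt Nf reg M₀) (hQ : ¬ QCDOf Nf) : ¬ LightQuarkCompletion :=
  not_lightQuarkCompletion_iff.mpr ⟨Nf, hNf, hpkg, fun h => hQ (concl_qcdOf h)⟩

/-! ## §3 Load-bearing analysis of the hypotheses

Three hypotheses are IDLE (the crux with the hypothesis deleted is EQUIVALENT to the crux): asymptotic scaling, `0 ≤ M₀`, the
weak branch.  The mechanism for the branch is the RGI up-shift `upShift reg D` (`m_crit ↦ m_crit + a D / Z_m`), under which the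
scheme at tuple `m` is the scheme at `D + m`, the pin above `M₀` becomes the pin above `M₀ + D`, and the body above `M₀` becomes
the body above `M₀ − D`. -/

/-- The body forces asymptotic scaling of `reg.scheme 0 0 0` (IsQCDAlong's first clause reads only `β, a`). -/
theorem body_hasAsymptoticScaling {reg : QCDRegularisation Nf} {M₀ : ℝ} (h : Body Nf reg M₀) :
    (reg.scheme 0 0 0).HasAsymptoticScaling := by
  obtain ⟨z, shift, T, hQ, -⟩ := h (fun _ => M₀ + 1) (fun _ => by linarith)
  exact hQ.1

/-- The body forces the branch clause of every realised bare trajectory above `M₀` (IsQCDAlong's second clause): for every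
tuple `m > M₀` and flavour `f`, eventually `−1 < m_crit k + a_k m_f / Z_m k`.  The crux's weak-branch hypothesis
`∀ᶠ k, −1 ≤ m_crit k` is this up to the sliver `a_k (M₀ + ε)/Z_m k → 0`. -/
theorem body_branch_sliver {reg : QCDRegularisation Nf} {M₀ : ℝ} (h : Body Nf reg M₀) (m : Fin Nf → ℝ)
    (hm : ∀ f, M₀ < m f) (f : Fin Nf) : ∀ᶠ k : ℕ in atTop, -1 < reg.mcrit k + reg.a k * m f / reg.Zm k := by
  obtain ⟨z, shift, T, hQ, -⟩ := h m hm
  exact hQ.2.1 f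

/-- The pin above `M₀` is the pin above every `M₁ ≥ M₀`. -/
theorem pinPkg_mono {reg : QCDRegularisation Nf} {M₀ M₁ : ℝ} (h : PinPkg Nf reg M₀) (hle : M₀ ≤ M₁) :
    PinPkg Nf reg M₁ := by
  intro m hm
  obtain ⟨R, hR, hlo, hup⟩ := h m fun f => lt_of_le_of_lt hle (hm f)
  exact ⟨R, hR, fun M hM => hlo M (lt_of_le_of_lt hle hM), fun M hM => hup M (lt_of_le_of_lt hle hM)⟩

/-- The body above `M₀` is the body above every `M₁ ≥ M₀`. -/
theorem body_mono {reg : QCDRegularisation Nf} {M₀ M₁ : ℝ} (h : Body Nf reg M₀) (hle : M₀ ≤ M₁) : Body Nf reg M₁ :=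
  fun m hm => h m fun f => lt_of_le_of_lt hle (hm f)

/-- **`HasAsymptoticScaling` is idle**: the crux with hypothesis 2 deleted. -/
def WithoutHAS : Prop :=
  ∀ Nf : ℕ, (Nf = 2 ∨ Nf = 3) → ∀ reg : QCDRegularisation Nf, reg.HasMassScaling →
    (∀ᶠ k : ℕ in atTop, -1 ≤ reg.mcrit k) → ∀ M₀ : ℝ, 0 ≤ M₀ → PinPkg Nf reg M₀ → Body Nf reg M₀ → Concl Nf

/-- `LightQuarkCompletion ↔ WithoutHAS` (the body supplies the deleted hypothesis). -/
theorem lightQuarkCompletion_iff_withoutHAS : LightQuarkCompletion ↔ WithoutHAS := by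
  rw [lightQuarkCompletion_iff]
  constructor
  · intro h Nf hNf reg hMS hbr M₀ hM₀ hpin hbody
    exact h Nf hNf reg M₀ ⟨hMS, body_hasAsymptoticScaling hbody, hbr, hM₀, hpin, hbody⟩
  · rintro h Nf hNf reg M₀ ⟨hMS, -, hbr, hM₀, hpin, hbody⟩
    exact h Nf hNf reg hMS hbr M₀ hM₀ hpin hbody

/-- **`0 ≤ M₀` is idle**: the crux with hypothesis 4 deleted (any real threshold). -/
def WithoutSign : Prop :=
  ∀ Nf : ℕ, (Nf = 2 ∨ Nf = 3) → ∀ reg : QCDRegularisation Nf, reg.HasMassScaling →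
    (reg.scheme 0 0 0).HasAsymptoticScaling → (∀ᶠ k : ℕ in atTop, -1 ≤ reg.mcrit k) → ∀ M₀ : ℝ,
      PinPkg Nf reg M₀ → Body Nf reg M₀ → Concl Nf

/-- `LightQuarkCompletion ↔ WithoutSign` (raise a negative threshold to `0` by monotonicity). -/
theorem lightQuarkCompletion_iff_withoutSign : LightQuarkCompletion ↔ WithoutSign := by
  rw [lightQuarkCompletion_iff]
  constructor
  · intro h Nf hNf reg hMS hAS hbr M₀ hpin hbody
    exact h Nf hNf reg (max M₀ 0)
      ⟨hMS, hAS, hbr, le_max_right _ _, pinPkg_mono hpin (le_max_left _ _), body_mono hbody (le_max_left _ _)⟩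
  · rintro h Nf hNf reg M₀ ⟨hMS, hAS, hbr, -, hpin, hbody⟩
    exact h Nf hNf reg hMS hAS hbr M₀ hpin hbody

/-! ### The RGI up-shift and the idleness of the weak branch -/

/-- **The RGI up-shift** of a regularisation by `D`: `m_crit(k) ↦ m_crit(k) + a_k D / Z_m(k)`, all other data kept. -/
def upShift (reg : QCDRegularisation Nf) (D : ℝ) : QCDRegularisation Nf :=
  { reg with mcrit := fun k => reg.mcrit k + reg.a k * D / reg.Zm k }

@[simp] theorem upShift_a (reg : QCDRegularisation Nf) (D : ℝ) : (upShift reg D).a = reg.a := rfl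
@[simp] theorem upShift_β (reg : QCDRegularisation Nf) (D : ℝ) : (upShift reg D).β = reg.β := rfl
@[simp] theorem upShift_L (reg : QCDRegularisation Nf) (D : ℝ) : (upShift reg D).L = reg.L := rfl
@[simp] theorem upShift_Zm (reg : QCDRegularisation Nf) (D : ℝ) : (upShift reg D).Zm = reg.Zm := rfl
@[simp] theorem upShift_mcrit (reg : QCDRegularisation Nf) (D : ℝ) (k : ℕ) :
    (upShift reg D).mcrit k = reg.mcrit k + reg.a k * D / reg.Zm k := rfl

/-- The up-shifted scheme at tuple `m` IS the original scheme at tuple `D + m`. -/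
theorem upShift_scheme (reg : QCDRegularisation Nf) (D : ℝ) (m : Fin Nf → ℝ) (z shift : QCDField Nf → ℕ → ℝ) :
    (upShift reg D).scheme m z shift = reg.scheme (fun f => D + m f) z shift := by
  simp only [upShift, QCDRegularisation.scheme, QCDScheme.mk.injEq, true_and, and_true]
  funext f k
  ring

/-- The up-shift keeps mass scaling (which never reads `m_crit`). -/
theorem hasMassScaling_upShift (reg : QCDRegularisation Nf) (D : ℝ) :
    (upShift reg D).HasMassScaling ↔ reg.HasMassScaling := Iff.rfl

/-- The up-shift keeps asymptotic scaling (which reads only `β, a`). -/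
theorem hasAsymptoticScaling_upShift (reg : QCDRegularisation Nf) (D : ℝ) :
    ((upShift reg D).scheme 0 0 0).HasAsymptoticScaling ↔ (reg.scheme 0 0 0).HasAsymptoticScaling := Iff.rfl

/-- `m_crit → 0` survives the up-shift (`a_k D / Z_m(k) → 0` by mass scaling, `N_f ≤ 16`). -/
theorem tendsto_mcrit_upShift (reg : QCDRegularisation Nf) (D : ℝ) (hNf : Nf ≤ 16) (hMS : reg.HasMassScaling)
    (h : Tendsto reg.mcrit atTop (𝓝 0)) : Tendsto (upShift reg D).mcrit atTop (𝓝 0) := by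
  have haz : Tendsto (fun k => reg.a k / reg.Zm k * D) atTop (𝓝 0) := by
    simpa using (tendsto_a_div_Zm reg hMS (massExponent_pos hNf)).mul_const D
  have hsum := h.add haz
  rw [add_zero] at hsum
  refine hsum.congr fun k => ?_
  show reg.mcrit k + reg.a k / reg.Zm k * D = reg.mcrit k + reg.a k * D / reg.Zm k
  ring

/-- **The lower pin is up-shift covariant**: the lower pin of `reg` above `M₀` with sea tuple `D + m` is the lower pin of
`upShift reg D` above `M₀ + D` with sea tuple `m` (`D ≥ 0`; same bare data, offsets re-based). -/
theorem pinClause_upShift {reg : QCDRegularisation Nf} {M₀ D : ℝ} {m : Fin Nf → ℝ} {R : ℝ}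
    (h : PinClause Nf reg M₀ (fun f => D + m f) R) : PinClause Nf (upShift reg D) (M₀ + D) m R := by
  intro M hM
  have h1 : ∀ k, reg.mcrit k + reg.a k * D / reg.Zm k - reg.a k * M / reg.Zm k =
      reg.mcrit k - reg.a k * (M - D) / reg.Zm k := fun k => by ring
  have h2 : ∀ (k) (f : Fin Nf), reg.mcrit k + reg.a k * D / reg.Zm k + reg.a k * m f / reg.Zm k =
      reg.mcrit k + reg.a k * (D + m f) / reg.Zm k := fun k f => by ring
  filter_upwards [h (M - D) (by linarith)] with k hk S hS
  have hk' := hk S hS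
  simp only [upShift_a, upShift_β, upShift_mcrit, upShift_Zm, h1, h2] at hk' ⊢
  exact hk'

/-- **The upper pin is up-shift covariant** (same re-basing). -/
theorem upperPin_upShift {reg : QCDRegularisation Nf} {M₀ D : ℝ} (hD : 0 ≤ D) {m : Fin Nf → ℝ} {R : ℝ}
    (h : UpperPin Nf reg M₀ (fun f => D + m f) R) : UpperPin Nf (upShift reg D) (M₀ + D) m R := by
  intro M hM
  have h1 : ∀ k, reg.mcrit k + reg.a k * D / reg.Zm k + reg.a k * M / reg.Zm k =
      reg.mcrit k + reg.a k * (M + D) / reg.Zm k := fun k => by ring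
  have h2 : ∀ (k) (f : Fin Nf), reg.mcrit k + reg.a k * D / reg.Zm k + reg.a k * m f / reg.Zm k =
      reg.mcrit k + reg.a k * (D + m f) / reg.Zm k := fun k f => by ring
  filter_upwards [h (M + D) (by linarith)] with k hk S hS hS2
  have hk' := hk S hS hS2
  simp only [upShift_a, upShift_β, upShift_mcrit, upShift_Zm, h1, h2] at hk' ⊢
  exact hk'

/-- **The two-sided pin is up-shift covariant**: pin above `M₀` for `reg` ⇒ pin above `M₀ + D` for `upShift reg D` (`D ≥ 0`). -/
theorem pinPkg_upShift {reg : QCDRegularisation Nf} {M₀ D : ℝ} (hD : 0 ≤ D) (h : PinPkg Nf reg M₀) :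
    PinPkg Nf (upShift reg D) (M₀ + D) := by
  intro m hm
  obtain ⟨R, hR, hlo, hup⟩ := h (fun f => D + m f) fun f => by linarith [hm f]
  exact ⟨R, hR, pinClause_upShift hlo, upperPin_upShift hD hup⟩

/-- **The body is up-shift covariant**: body above `M₀` for `reg` ⇒ body above `M₁` for `upShift reg D` whenever
`M₀ ≤ M₁ + D`. -/
theorem body_upShift {reg : QCDRegularisation Nf} {M₀ M₁ D : ℝ} (hM : M₀ ≤ M₁ + D) (h : Body Nf reg M₀) :
    Body Nf (upShift reg D) M₁ := by
  intro m hm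
  obtain ⟨z, shift, T, hQ, hN, hG, hP, Δ, hΔ, hT, hL⟩ := h (fun f => D + m f) fun f => by linarith [hm f]
  refine ⟨z, shift, T, ?_, hN, hG, hP, Δ, hΔ, hT, ?_⟩
  · rwa [upShift_scheme]
  · rwa [upShift_scheme]

/-- **After the up-shift by `D > M₀` the weak branch is AUTOMATIC**: the body's own branch clause at the tuple `D·1` gives
`−1 < m_crit k + a_k D / Z_m k = (upShift reg D).mcrit k` eventually (`N_f ≠ 0` to name a flavour). -/
theorem body_branch_upShift [NeZero Nf] {reg : QCDRegularisation Nf} {M₀ D : ℝ} (h : Body Nf reg M₀) (hD : M₀ < D) :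
    ∀ᶠ k : ℕ in atTop, -1 ≤ (upShift reg D).mcrit k := by
  have hf := body_branch_sliver h (fun _ => D) (fun _ => hD) (0 : Fin Nf)
  filter_upwards [hf] with k hk
  rw [upShift_mcrit]
  exact hk.le

/-- **The weak branch is idle**: the crux with hypothesis 3 deleted. -/
def WithoutBranch : Prop :=
  ∀ Nf : ℕ, (Nf = 2 ∨ Nf = 3) → ∀ reg : QCDRegularisation Nf, reg.HasMassScaling →
    (reg.scheme 0 0 0).HasAsymptoticScaling → ∀ M₀ : ℝ, 0 ≤ M₀ → PinPkg Nf reg M₀ → Body Nf reg M₀ → Concl Nf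

/-- **`LightQuarkCompletion ↔ WithoutBranch`.**  Given the package WITHOUT the weak branch at `(reg, M₀)`, the up-shift
`reg₂ := upShift reg (M₀ + 1)` carries both scalings, the pin above `2M₀ + 1`, the body above `2M₀ + 1` AND the weak branch
(from the body's IsQCDAlong clause at the tuple `(M₀+1)·1`), so the crux applies to `reg₂` — and its conclusion is `reg`-free.
Consequence for the line: the binder `hbr` threads no information that `hbody` does not already carry (at RGI precision). -/
theorem lightQuarkCompletion_iff_withoutBranch : LightQuarkCompletion ↔ WithoutBranch := by
  rw [lightQuarkCompletion_iff]
  constructor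
  · intro h Nf hNf reg hMS hAS M₀ hM₀ hpin hbody
    haveI : NeZero Nf := ⟨by rcases hNf with rfl | rfl <;> norm_num⟩
    have hbr₂ := body_branch_upShift (D := M₀ + 1) hbody (by linarith)
    refine h Nf hNf (upShift reg (M₀ + 1)) (M₀ + (M₀ + 1))
      ⟨(hasMassScaling_upShift reg _).mpr hMS, (hasAsymptoticScaling_upShift reg _).mpr hAS, hbr₂, by linarith,
        pinPkg_upShift (by linarith) hpin, body_upShift (by linarith) hbody⟩
  · rintro h Nf hNf reg M₀ ⟨hMS, hAS, -, hM₀, hpin, hbody⟩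
    exact h Nf hNf reg hMS hAS M₀ hM₀ hpin hbody


/-! ## §4 Line `Sketch` — stub J (`stub_jumpLineIsChiral`): the zero-threshold pin is load-bearing

The lead's skeleton (`Cruxes/LightQuarkCompletion/Lines/Sketch.lean`, glue landed as
`Theorems/NestedDissectionSeaLightQuarkCompletionGlue.lean`, `lightQuarkCompletion_of_stubs`) closes the crux from four stubs;
joint sufficiency is kernel-checked there.  Stub J reads: a regularisation with both scalings, `m_crit' → 0`, the two-sided pin
at ZERO threshold and the body at every positive tuple is chiral at zero.  Below: (i) `StubJumpLineIsChiral` is that signature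
VERBATIM (`stubJumpLineIsChiral_iff` re-reads it over `PinPkg`/`Body`); (ii) every hypothesis of J EXCEPT the pin passes from a
threshold regularisation to all its RGI up-shifts (`jHypsMinusPin_upShift`), while the pin only travels to the RAISED threshold
(`pinPkg_upShift`); (iii) modulo the believed-true, here unconstructible `UniformlyGappedBranchThresholdQCD N_f` (threshold QCD
on the physical branch with ONE lattice gap rate above its threshold — the expected shape of the bridge's own output), J WITH THE
PIN DELETED is FALSE (`stubJumpLineIsChiral_false_without_pin`): the up-shift of that regularisation by its threshold satisfies
all remaining hypotheses and is provably not chiral at zero.  Moral for the J-prover: the proof must consume the zero-threshold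
pin (physically: its LOWER clause on the smallest admissible tori, which an up-shifted line violates); `m_crit' → 0`, both
scalings and the body are blind to RGI re-centring and cannot do it. -/

/-- **Stub J, VERBATIM** the registered signature of `LightQuarkJumpLine.stub_jumpLineIsChiral`.  Statement abbreviation
(OPEN; not asserted). -/
def StubJumpLineIsChiral : Prop :=
  ∀ Nf : ℕ, (Nf = 2 ∨ Nf = 3) → ∀ reg' : QCDRegularisation Nf,
    reg'.HasMassScaling → (reg'.scheme 0 0 0).HasAsymptoticScaling → Tendsto reg'.mcrit atTop (𝓝 0) →
    (∀ m : Fin Nf → ℝ, (∀ f, 0 < m f) → ∃ R : ℝ, 0 < R ∧ PinClause Nf reg' 0 m R ∧ UpperPin Nf reg' 0 m R) →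
    (∀ m : Fin Nf → ℝ, (∀ f, 0 < m f) → ∃ (z shift : QCDField Nf → ℕ → ℝ) (T : OSData (QCDField Nf) 4),
      IsQCDAlong (reg'.scheme m z shift) T ∧ T.IsNontrivial QCDField.glue ∧ T.IsNonGaussian QCDField.glue ∧
        (∀ f g : Fin Nf, f ≠ g → T.IsNontrivial (QCDField.pseudoRe f g)) ∧
          ∃ Δ > 0, T.HasMassGap Δ ∧ (reg'.scheme m z shift).HasLatticeMassGap Δ) →
    reg'.IsChiralAtZero

/-- Stub J over the abbreviations (definitional). -/
theorem stubJumpLineIsChiral_iff :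
    StubJumpLineIsChiral ↔ ∀ Nf : ℕ, (Nf = 2 ∨ Nf = 3) → ∀ reg' : QCDRegularisation Nf,
      reg'.HasMassScaling → (reg'.scheme 0 0 0).HasAsymptoticScaling → Tendsto reg'.mcrit atTop (𝓝 0) →
        PinPkg Nf reg' 0 → Body Nf reg' 0 → reg'.IsChiralAtZero :=
  Iff.rfl

/-- **Stub J with the zero-threshold pin DELETED.**  Statement abbreviation; FALSE modulo
`UniformlyGappedBranchThresholdQCD`, see `stubJumpLineIsChiral_false_without_pin`. -/
def StubJumpLineIsChiralWithoutPin : Prop :=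
  ∀ Nf : ℕ, (Nf = 2 ∨ Nf = 3) → ∀ reg' : QCDRegularisation Nf,
    reg'.HasMassScaling → (reg'.scheme 0 0 0).HasAsymptoticScaling → Tendsto reg'.mcrit atTop (𝓝 0) →
      Body Nf reg' 0 → reg'.IsChiralAtZero

/-- **H — uniformly gapped threshold QCD on the physical branch** (believed TRUE, not constructible in the tree): some
regularisation with both scalings and `m_crit → 0` carries the `QCDOf` body above a threshold `M₀ ≥ 0` AND has ONE lattice gap
rate `ε > 0` at every tuple above `M₀` (heavier quarks do not close the gap).  It is the crux's own hypothesis package with the pin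
replaced by `m_crit → 0` plus mass-uniformity of the gap — the expected shape of every honest output of `SeaFactorisationBridge`.
[topic constructive-qft] -/
def UniformlyGappedBranchThresholdQCD (Nf : ℕ) : Prop :=
  ∃ reg : QCDRegularisation Nf, reg.HasMassScaling ∧ (reg.scheme 0 0 0).HasAsymptoticScaling ∧
    Tendsto reg.mcrit atTop (𝓝 0) ∧ ∃ M₀ : ℝ, 0 ≤ M₀ ∧ Body Nf reg M₀ ∧
      ∃ ε > (0 : ℝ), ∀ m : Fin Nf → ℝ, (∀ f, M₀ < m f) → (reg.scheme m 0 0).HasLatticeMassGap ε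

/-- **A uniform gap above `M₀` refutes chirality of every up-shift by `D ≥ M₀`** (the shifted scheme at a positive tuple `m`
is the original scheme at `D + m`, all components `> M₀`). -/
theorem not_isChiralAtZero_upShift_of_uniformGapAbove (reg : QCDRegularisation Nf) {M₀ ε D : ℝ} (hε : 0 < ε)
    (hgap : ∀ m : Fin Nf → ℝ, (∀ f, M₀ < m f) → (reg.scheme m 0 0).HasLatticeMassGap ε) (hD : M₀ ≤ D) :
    ¬ (upShift reg D).IsChiralAtZero := by
  intro hχ
  obtain ⟨m, hm, hno⟩ := hχ ε hε
  apply hno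
  rw [upShift_scheme]
  exact hgap _ fun f => by linarith [hm f]

/-- **Every hypothesis of J except the pin is blind to RGI up-shifts of a threshold regularisation**: from both scalings,
`m_crit → 0` and the body above `M₀`, the up-shift by any `D ≥ M₀` has both scalings, `m_crit → 0` and the body at EVERY
positive tuple (`N_f ≤ 16`) — while its pin, if `reg` had one above `M₀`, is only certified above `M₀ + D` (`pinPkg_upShift`). -/
theorem jHypsMinusPin_upShift (hNf : Nf ≤ 16) (reg : QCDRegularisation Nf) {M₀ D : ℝ} (hD : M₀ ≤ D)
    (hMS : reg.HasMassScaling) (hAS : (reg.scheme 0 0 0).HasAsymptoticScaling) (hlim : Tendsto reg.mcrit atTop (𝓝 0))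
    (hbody : Body Nf reg M₀) :
    (upShift reg D).HasMassScaling ∧ ((upShift reg D).scheme 0 0 0).HasAsymptoticScaling ∧
      Tendsto (upShift reg D).mcrit atTop (𝓝 0) ∧ Body Nf (upShift reg D) 0 :=
  ⟨(hasMassScaling_upShift reg D).mpr hMS, (hasAsymptoticScaling_upShift reg D).mpr hAS,
    tendsto_mcrit_upShift reg D hNf hMS hlim, body_upShift (M₁ := 0) (by linarith) hbody⟩

/-- **THE PIN IS LOAD-BEARING IN STUB J (modulo H).**  If uniformly gapped threshold QCD on the physical branch exists at
`N_f ∈ {2,3}`, then stub J with its zero-threshold pin deleted is FALSE: the up-shift of the H-regularisation by its threshold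
`M₀` has both scalings, `m_crit → 0` and the body at every positive tuple, and is NOT chiral at zero.  Hence any proof of J uses
the pin; and since the countermodel has `m_crit → 0`, the hypothesis `Tendsto reg'.mcrit atTop (𝓝 0)` is NOT what excludes it. -/
theorem stubJumpLineIsChiral_false_without_pin (hNf : Nf = 2 ∨ Nf = 3) (H : UniformlyGappedBranchThresholdQCD Nf) :
    ¬ StubJumpLineIsChiralWithoutPin := by
  intro hJ
  obtain ⟨reg, hMS, hAS, hlim, M₀, hM₀, hbody, ε, hε, hgap⟩ := H
  have hNf16 : Nf ≤ 16 := by rcases hNf with rfl | rfl <;> norm_num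
  obtain ⟨hMS', hAS', hlim', hbody'⟩ := jHypsMinusPin_upShift hNf16 reg le_rfl hMS hAS hlim hbody
  exact not_isChiralAtZero_upShift_of_uniformGapAbove reg hε hgap le_rfl (hJ Nf hNf (upShift reg M₀) hMS' hAS' hlim' hbody')

/-- The same up-shift read against the FULL stub J: it satisfies every hypothesis but is certified to carry the pin only above
`2M₀` (from a pin above `M₀`), never at `0` — J is consistent with H exactly because its pin is at ZERO threshold. -/
theorem upShift_pin_only_above (reg : QCDRegularisation Nf) {M₀ : ℝ} (hM₀ : 0 ≤ M₀) (hpin : PinPkg Nf reg M₀) :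
    PinPkg Nf (upShift reg M₀) (M₀ + M₀) :=
  pinPkg_upShift hM₀ hpin

/-! ## §5 Line `Sketch` — stub B2b (`stub_physicalBranch`): scalings + weak branch + UPPER pins do not locate the line

Stub B2b concludes `m_crit → 0` for a threshold regularisation whose re-centring at some germ carries the zero-threshold pin.
Deleting the body AND both LOWER pins (the threshold one and the re-centred one) leaves a FALSE statement: along the heavy junk
regularisation `heavyJunkReg 2` (`canonicalAF` with `m_crit ≡ 1`, both scalings, weak branch trivially) every upper pin holds
OUTRIGHT — its indicator is empty by Seiler positivity at positive bare mass — while `m_crit ≡ 1 ↛ 0`.  So B2b's information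
"the line is near `0`, not in `[−1, 0)` and not at `+1`" must come from a LOWER pin or from the body (non-decoupled dynamical
quarks / IsQCDAlong); cf. the sibling fact `FrameAndSeparatorLawNegative.frameWithoutLowerPin_false` for the frame (α). -/

/-- **The upper pin is free wherever its mass is positive** (Seiler positivity empties the indicator; any `reg`, tuple, `R`). -/
theorem upperPin_of_pos_mass (reg : QCDRegularisation Nf) {M₀ : ℝ} (m : Fin Nf → ℝ) (R : ℝ)
    (hpos : ∀ M : ℝ, M₀ < M → ∀ k : ℕ, 0 < reg.mcrit k + reg.a k * M / reg.Zm k) : UpperPin Nf reg M₀ m R := by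
  intro M hM
  refine Filter.Eventually.of_forall fun k S _hS _hS2 => ?_
  dsimp only
  have hp : ∀ U : GaugeConfig 4 (2 * S + 1) (Matrix.specialUnitaryGroup (Fin 3) ℂ),
      ¬ (fermionDet (wilsonDirac (fundamentalRep (Fin 3)) U (reg.mcrit k + reg.a k * M / reg.Zm k) 1)).re < 0 :=
    fun U => not_lt.mpr (fermionDet_wilsonDirac_re_pos (fundamentalRep (Fin 3))
      fundamentalRep_mem_unitaryGroup U (hpos M hM k)).le
  simp [hp]

/-- **Stub B2b with the body and both LOWER pins deleted** (upper pins, scalings, weak branch kept; the re-centred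
regularisation written exactly as in the registered signature).  Statement abbreviation; FALSE. -/
def StubPhysicalBranchWithoutBodyAndLowerPins : Prop :=
  ∀ Nf : ℕ, (Nf = 2 ∨ Nf = 3) → ∀ reg : QCDRegularisation Nf, reg.HasMassScaling →
    (reg.scheme 0 0 0).HasAsymptoticScaling → (∀ᶠ k : ℕ in atTop, -1 ≤ reg.mcrit k) → ∀ M₀ : ℝ, 0 ≤ M₀ →
    (∀ m : Fin Nf → ℝ, (∀ f, M₀ < m f) → ∃ R : ℝ, 0 < R ∧ UpperPin Nf reg M₀ m R) →
    ∀ J : ℝ, (∀ m : Fin Nf → ℝ, (∀ f, 0 < m f) → ∃ R : ℝ, 0 < R ∧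
      UpperPin Nf (QCDRegularisation.mk reg.a reg.a_pos reg.tendsto_a reg.β reg.L reg.tendsto_L
        (fun k => reg.mcrit k + reg.a k * J / reg.Zm k) reg.Zm reg.Zm_pos) 0 m R) →
    Tendsto reg.mcrit atTop (𝓝 0)

/-- **B2b needs the body or a lower pin**: `StubPhysicalBranchWithoutBodyAndLowerPins` is FALSE (witness `heavyJunkReg 2`,
germ `J = 0`). [folklore] -/
theorem stubPhysicalBranch_false_without_body_and_lowerPins : ¬ StubPhysicalBranchWithoutBodyAndLowerPins := by
  intro h
  obtain ⟨hms, has, M₀, hM₀, b₀, -, ℓ, -, hm⟩ := withoutLowerPinAt_heavyJunkReg 2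
  have hbr : ∀ᶠ k : ℕ in atTop, -1 ≤ (heavyJunkReg 2).mcrit k :=
    Filter.Eventually.of_forall fun k => by
      show (-1 : ℝ) ≤ 1
      norm_num
  have hup : ∀ m : Fin 2 → ℝ, (∀ f, M₀ < m f) → ∃ R : ℝ, 0 < R ∧ UpperPin 2 (heavyJunkReg 2) M₀ m R :=
    fun m hmm => by
      obtain ⟨R, hR, -, hu⟩ := hm m hmm
      exact ⟨R, hR, hu⟩
  have hup0 : ∀ m : Fin 2 → ℝ, (∀ f, 0 < m f) → ∃ R : ℝ, 0 < R ∧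
      UpperPin 2 (QCDRegularisation.mk (heavyJunkReg 2).a (heavyJunkReg 2).a_pos (heavyJunkReg 2).tendsto_a
        (heavyJunkReg 2).β (heavyJunkReg 2).L (heavyJunkReg 2).tendsto_L
        (fun k => (heavyJunkReg 2).mcrit k + (heavyJunkReg 2).a k * 0 / (heavyJunkReg 2).Zm k)
        (heavyJunkReg 2).Zm (heavyJunkReg 2).Zm_pos) 0 m R := fun m _ =>
    ⟨1, one_pos, upperPin_of_pos_mass _ m 1 fun M hM k => by
      have ha := (heavyJunkReg 2).a_pos k
      have hZ := (heavyJunkReg 2).Zm_pos k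
      have h1 : (heavyJunkReg 2).mcrit k = 1 := rfl
      show 0 < (heavyJunkReg 2).mcrit k + (heavyJunkReg 2).a k * 0 / (heavyJunkReg 2).Zm k +
        (heavyJunkReg 2).a k * M / (heavyJunkReg 2).Zm k
      rw [h1]
      positivity⟩
  have hT : Tendsto (heavyJunkReg 2).mcrit atTop (𝓝 0) :=
    h 2 (Or.inl rfl) (heavyJunkReg 2) hms has hbr M₀ hM₀ hup 0 hup0
  have h1 : Tendsto (heavyJunkReg 2).mcrit atTop (𝓝 1) := tendsto_const_nhds
  have h01 := tendsto_nhds_unique hT h1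
  norm_num at h01

/-! ## §6 Why the crux resists a Lean kill, and what was tried (cycle 1)

* **No junk instance of the hypotheses.**  `Body` needs, at EVERY tuple above `M₀`, OS data `T` with `IsNontrivial glue`,
  `IsNonGaussian glue`, dynamical flavoured pseudoscalars and `T.HasMassGap`, tied by `IsQCDAlong` to the honest lattice
  expectations `qcdLatticeSchwinger`, plus the honest `HasLatticeMassGap` (reads `β_k, L_k, a_k, m_f(k)` only): the tree's one
  cheap inhabitant of `IsQCDAlong` is the vacuum along `z ≡ 0` (`isQCDAlong_zeroAF_vacuum`), excluded by non-triviality.  `PinPkg`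
  needs a phase-quenched sign probability `≥ 1/4` (lower pin); the only closed-form evaluation available is Seiler positivity
  (`P = 0` off `(−8, 0)`, `PinWindow`), which EMPTIES upper pins (§5) and can only make lower pins FAIL.
* **No provable negation of the conclusion.**  `Concl Nf → QCDOf Nf` (§1); `¬ Concl` would disprove pinned chiral QCD.
  Internal-inconsistency probes all fail: the zero-threshold lower pin forces `m_crit' k − a_k M/Z_m k ∈ (−8, 0)` for every
  `M > 0` eventually (`PinClause.mass_mem_Ioo`), i.e. `limsup m_crit'·Z_m/a ≤ 0`, compatible with `m_crit' → 0`; the `0/0 = 0`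
  junk of the ratio only bites if `∫ wt = 0`, impossible for a product of norms of non-zero polynomials a.e.; `IsChiralAtZero` asks
  one gapless tuple per rate and is compatible with `∃ Δ(m) > 0` at every tuple.
* **Dropped hypotheses.**  HAS, `0 ≤ M₀`, weak branch: idle (§3).  `N_f ∈ {2,3}`, `HasMassScaling`, pin, body: deleting any of
  them only ENLARGES a `reg`-free implication's antecedent by classes with no constructible member (e.g. runaway `Z_m`, strong
  coupling `β ≡ 0` is excluded anyway by the body's own HAS), so neither `_false_without_` nor `_iff_without_` is reachable.
* **Natural strengthenings.**  (S1) keep-`reg` ("`reg` re-centred at a germ, no subsequence") and (S2) "the witness is an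
  up-shift of `reg`": not refutable (antecedent uninhabitable); (S3) PIN RIGIDITY ("two regularisations differing by an RGI
  offset `D ≠ 0` cannot both carry the zero-threshold pin"), used informally by the cards: NOT a theorem of the typed clauses —
  the upper pin lives on tori of side in `[R, 2R]` with `R` chosen per `(reg, m)`, and a competing package may take `R' > 2R`, so
  the lower pin of one and the upper pin of the other need not meet on a common torus; physically true (lower pin fails on the
  smallest admissible tori of an up-shifted line).  Provers must not cite rigidity as a lemma.
* **Degenerate regimes.**  `M₀ = 0`: the crux still contains J (chirality of the re-pinned line).  `M₀ → ∞`: hypotheses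
  weaken monotonically (§3), the crux is its own `M₀ → ∞` limit "QCD at all masses from QCD above any threshold" — dilation
  covariance `(a, Λ, m) ↦ (λa, Λ/λ, m/λ)` (ideator 2) makes every `M₀/Λ` equivalent.  `N_f = 0, 1`: outside the crux; for
  `N_f = 1` stub J is physically FALSE (gapped chiral limit), which is why J needs a flavour input (card anomaly-at-the-pinned-corner)
  — not expressible as a Lean countermodel (needs 1-flavour lattice QCD).
* **Literature / numerics.**  The route's falsifiers F0′ (jump `κ` vs `κ_c`) and F6′ (sea-mass dependence of `κ_c` in RGI
  units) are statements at accessible `β`, while every clause here is `∀ᶠ k`; no finite computation binds.  Not run.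
* **Negatives index / barriers.**  `ledger negatives`: nothing on 18066; `AokiPhaseDichotomy`, `WilsonDeterminantSign`,
  `BanksCasherCriterion` do not bite along `a_k → 0` with RGI-resolution clauses (grounder g72-3, rattack-18066-0 concur).
-/


/-! ## §7 Line `Sketch` — stub B2a (`stub_jumpGerm`): the germ comes from the threshold LOWER pin or the body (cycle 2)

Stub B2a concludes, from the threshold package, a subsequence `φ` and a germ `J` such that the reindexed regularisation
re-centred at `J` carries BOTH zero-threshold pins.  Deleting the body and the threshold LOWER pin leaves a FALSE statement
(witness again `heavyJunkReg 2`, which carries every upper pin for free, §5): the conclusion contains a zero-threshold LOWER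
pin, whose pin mass must eventually lie in `(−8, 0)` (`PinClause.mass_mem_Ioo`), whereas along any subsequence and any
re-centring of the heavy junk regularisation that mass is `1 + a_{φ k}(J − M)/Z_m(φ k) → 1`.  With the threshold lower pin kept,
B2a at `M₀ = 0` is PROVED by the lead's B2a worker (`LightQuarkJumpLine.jumpGerm_of_zeroThreshold`, `φ = id`, `J = 0`); for
`M₀ > 0` the best re-centring `J = M₀` leaves the residual "lower pin THROUGH the band" (`jumpGerm_of_bandLowerPin`), and §8
shows the germ is confined to `[−M₀, M₀]` only modulo radius compatibility. -/

/-- **Stub B2a with the body and the threshold LOWER pin deleted** (both scalings, weak branch, threshold upper pins kept;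
conclusion verbatim: BOTH zero-threshold pins of the reindexed re-centred regularisation).  Statement abbreviation; FALSE. -/
def StubJumpGermWithoutBodyAndLowerPin : Prop :=
  ∀ Nf : ℕ, (Nf = 2 ∨ Nf = 3) → ∀ reg : QCDRegularisation Nf, reg.HasMassScaling →
    (reg.scheme 0 0 0).HasAsymptoticScaling → (∀ᶠ k : ℕ in atTop, -1 ≤ reg.mcrit k) → ∀ M₀ : ℝ, 0 ≤ M₀ →
    (∀ m : Fin Nf → ℝ, (∀ f, M₀ < m f) → ∃ R : ℝ, 0 < R ∧ UpperPin Nf reg M₀ m R) →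
    ∃ (φ : ℕ → ℕ) (hφ : StrictMono φ) (J : ℝ), ∀ m : Fin Nf → ℝ, (∀ f, 0 < m f) → ∃ R : ℝ, 0 < R ∧
      PinClause Nf (QCDRegularisation.mk (reg.restrict φ hφ.tendsto_atTop).a (reg.restrict φ hφ.tendsto_atTop).a_pos
        (reg.restrict φ hφ.tendsto_atTop).tendsto_a (reg.restrict φ hφ.tendsto_atTop).β (reg.restrict φ hφ.tendsto_atTop).L
        (reg.restrict φ hφ.tendsto_atTop).tendsto_L (fun k => (reg.restrict φ hφ.tendsto_atTop).mcrit k +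
          (reg.restrict φ hφ.tendsto_atTop).a k * J / (reg.restrict φ hφ.tendsto_atTop).Zm k)
        (reg.restrict φ hφ.tendsto_atTop).Zm (reg.restrict φ hφ.tendsto_atTop).Zm_pos) 0 m R ∧
      UpperPin Nf (QCDRegularisation.mk (reg.restrict φ hφ.tendsto_atTop).a (reg.restrict φ hφ.tendsto_atTop).a_pos
        (reg.restrict φ hφ.tendsto_atTop).tendsto_a (reg.restrict φ hφ.tendsto_atTop).β (reg.restrict φ hφ.tendsto_atTop).L
        (reg.restrict φ hφ.tendsto_atTop).tendsto_L (fun k => (reg.restrict φ hφ.tendsto_atTop).mcrit k +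
          (reg.restrict φ hφ.tendsto_atTop).a k * J / (reg.restrict φ hφ.tendsto_atTop).Zm k)
        (reg.restrict φ hφ.tendsto_atTop).Zm (reg.restrict φ hφ.tendsto_atTop).Zm_pos) 0 m R

/-- **B2a needs the threshold lower pin or the body**: `StubJumpGermWithoutBodyAndLowerPin` is FALSE (witness `heavyJunkReg 2`:
the concluded zero-threshold lower pin at `M = 1` would put `1 + a_{φ k}(J − 1)/Z_m(φ k)` eventually in `(−8, 0)`, but this
tends to `1`). [folklore] -/
theorem stubJumpGerm_false_without_body_and_lowerPin : ¬ StubJumpGermWithoutBodyAndLowerPin := by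
  intro h
  obtain ⟨hms, has, M₀, hM₀, b₀, -, ℓ, -, hm⟩ := withoutLowerPinAt_heavyJunkReg 2
  have hbr : ∀ᶠ k : ℕ in atTop, -1 ≤ (heavyJunkReg 2).mcrit k :=
    Filter.Eventually.of_forall fun k => by
      show (-1 : ℝ) ≤ 1
      norm_num
  have hup : ∀ m : Fin 2 → ℝ, (∀ f, M₀ < m f) → ∃ R : ℝ, 0 < R ∧ UpperPin 2 (heavyJunkReg 2) M₀ m R :=
    fun m hmm => by
      obtain ⟨R, hR, -, hu⟩ := hm m hmm
      exact ⟨R, hR, hu⟩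
  obtain ⟨φ, hφ, J, hJ⟩ := h 2 (Or.inl rfl) (heavyJunkReg 2) hms has hbr M₀ hM₀ hup
  obtain ⟨R, -, hlo, -⟩ := hJ (fun _ => 1) (fun _ => one_pos)
  have hIoo := hlo.mass_mem_Ioo (M := 1) one_pos
  have haz : Tendsto (fun k => (heavyJunkReg 2).a (φ k) / (heavyJunkReg 2).Zm (φ k)) atTop (𝓝 0) :=
    (tendsto_a_div_Zm (heavyJunkReg 2) hms (massExponent_pos (by norm_num))).comp hφ.tendsto_atTop
  have hsmall : ∀ᶠ k in atTop, |(heavyJunkReg 2).a (φ k) / (heavyJunkReg 2).Zm (φ k) * (J - 1)| < 1 := by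
    have h0 : Tendsto (fun k => (heavyJunkReg 2).a (φ k) / (heavyJunkReg 2).Zm (φ k) * (J - 1)) atTop (𝓝 0) := by
      simpa using haz.mul_const (J - 1)
    have := h0.abs
    simp only [abs_zero] at this
    exact this.eventually (gt_mem_nhds one_pos)
  obtain ⟨k, hk1, hk2⟩ := (hIoo.and hsmall).exists
  have hmc : (heavyJunkReg 2).mcrit (φ k) = 1 := rfl
  simp only [QCDRegularisation.restrict_a, QCDRegularisation.restrict_mcrit, QCDRegularisation.restrict_Zm,
    Function.comp_apply, hmc, Set.mem_Ioo] at hk1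
  have hlt := (abs_lt.mp hk2).1
  have heq : (1 : ℝ) + (heavyJunkReg 2).a (φ k) * J / (heavyJunkReg 2).Zm (φ k) -
      (heavyJunkReg 2).a (φ k) * 1 / (heavyJunkReg 2).Zm (φ k) =
        1 + (heavyJunkReg 2).a (φ k) / (heavyJunkReg 2).Zm (φ k) * (J - 1) := by ring
  rw [heq] at hk1
  linarith [hk1.2]

/-! ## §8 The pin clash: exactly how much "pin rigidity" the typed clauses carry (cycle 2)

Cycle 1 (§6, S3) recorded that PIN RIGIDITY ("two regularisations differing by an RGI offset cannot both carry the two-sided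
pin") is NOT a theorem of the typed clauses: the upper pin lives on sides in `[R, 2R]`, the lower pin on sides `≥ R`, the radii
being existential outputs per package and tuple.  Here is the EXACT positive statement, which isolates the missing datum as a
RADIUS COMPATIBILITY `R_lower < 2 R_upper`:

* `pin_clash`: a lower pin of `reg₁` and an upper pin of `reg₂` (same spacings and couplings, same sea weights, one common
  indicator bare mass) contradict as soon as `R₁ < 2R₂` — on the fine grid of odd sides `a_k(2S+1)`, `a_k → 0`, some side lies in
  `[max R₁ R₂, 2R₂]` (`exists_odd_side_between`), where the same phase-quenched ratio would be `≥ 1/4` and `≤ 1/8`;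
* for re-centrings of ONE regularisation (the line's situation): `germ_not_below_of_compatible` (`J < −M₀` clashes the
  zero-threshold UPPER pin of `upShift reg J` against the threshold LOWER pin of `reg`), `germ_not_above_of_compatible`
  (`M₀ < J`: zero-threshold LOWER pin of the re-centring against the threshold UPPER pin), `zeroGerm_unique_of_compatible`
  (two zero-threshold germs `J₁ < J₂` clash) — EACH ONLY under its radius compatibility, which no hypothesis supplies; and
  `lowerPinMass_lt_upperPinMass`: inside one package the mechanism never fires.

Moral for B2a/B2b/(α)-type arguments: rigidity needs radius bookkeeping — carry the radii and prove compatibility, or use an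
upper pin valid on `[R, 2R]` for EVERY `R ≥ R₀` (physically expected: at fixed `R` the early-crosser count on tori of side `≤ 2R`
vanishes as `k → ∞`), for which compatibility is automatic.  A NATURAL REPAIR of the crux making rigidity a theorem would
quantify the upper pin as `∀ R ≥ R₀, ∀ M > M₀, ∀ᶠ k, …` — recorded, not proposed (planner's call). -/

/-- **The grid of odd torus sides is fine.**  If the spacing `a > 0` satisfies `2a ≤ T − ρ` (`ρ > 0`), some odd torus side
`a(2S+1)` lies in `[ρ, T]`: take the least `S` with `ρ ≤ a(2S+1)`. [folklore] -/
theorem exists_odd_side_between {a ρ T : ℝ} (ha : 0 < a) (hρ : 0 < ρ) (hgap : 2 * a ≤ T - ρ) :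
    ∃ S : ℕ, ρ ≤ a * (2 * (S : ℝ) + 1) ∧ a * (2 * (S : ℝ) + 1) ≤ T := by
  have hex : ∃ S : ℕ, ρ ≤ a * (2 * (S : ℝ) + 1) := by
    obtain ⟨n, hn⟩ := exists_nat_ge (ρ / a)
    refine ⟨n, ?_⟩
    rw [div_le_iff₀ ha] at hn
    nlinarith
  refine ⟨Nat.find hex, Nat.find_spec hex, ?_⟩
  rcases Nat.eq_zero_or_pos (Nat.find hex) with h0 | hpos
  · rw [h0]
    push_cast
    linarith
  · obtain ⟨n, hn⟩ : ∃ n : ℕ, Nat.find hex = n + 1 := ⟨Nat.find hex - 1, by omega⟩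
    have hmin : ¬ ρ ≤ a * (2 * (n : ℝ) + 1) := Nat.find_min hex (by omega)
    rw [hn]
    push_cast
    nlinarith [not_le.mp hmin]

/-- **THE PIN CLASH.**  Let `reg₁, reg₂` have the same spacings and couplings, let the sea weights coincide
(`m_crit₂ + a m₂_f/Z_m₂ = m_crit₁ + a m₁_f/Z_m₁`), and let an admissible upper-pin mass of `reg₂` (height `M₂ > M₀₂`) coincide
with an admissible lower-pin mass of `reg₁` (depth `M₁ > M₀₁`).  Then the lower pin of `reg₁` (ratio `≥ 1/4` on every odd torus
of side `≥ R₁`, eventually) and the upper pin of `reg₂` (ratio `≤ 1/8` on odd tori of side in `[R₂, 2R₂]`, eventually) cannot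
both hold if `R₁ < 2R₂`: eventually `2a_k ≤ 2R₂ − max R₁ R₂`, a common torus exists, and there the two clauses bound the SAME
phase-quenched ratio.  WITHOUT `R₁ < 2R₂` nothing follows (the clauses never meet). [folklore] -/
theorem pin_clash {reg₁ reg₂ : QCDRegularisation Nf} {M₀₁ M₀₂ : ℝ} {m₁ m₂ : Fin Nf → ℝ} {R₁ R₂ : ℝ}
    (hlo : PinClause Nf reg₁ M₀₁ m₁ R₁) (hup : UpperPin Nf reg₂ M₀₂ m₂ R₂)
    (ha : ∀ k, reg₂.a k = reg₁.a k) (hβ : ∀ k, reg₂.β k = reg₁.β k)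
    (hw : ∀ k f, reg₂.mcrit k + reg₂.a k * m₂ f / reg₂.Zm k = reg₁.mcrit k + reg₁.a k * m₁ f / reg₁.Zm k)
    {M₁ M₂ : ℝ} (hM₁ : M₀₁ < M₁) (hM₂ : M₀₂ < M₂)
    (hμ : ∀ k, reg₂.mcrit k + reg₂.a k * M₂ / reg₂.Zm k = reg₁.mcrit k - reg₁.a k * M₁ / reg₁.Zm k)
    (hR₂ : 0 < R₂) (hR : R₁ < 2 * R₂) : False := by
  set ρ : ℝ := max R₁ R₂ with hρ
  have hρpos : 0 < ρ := lt_max_of_lt_right hR₂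
  have hρlt : ρ < 2 * R₂ := max_lt hR (by linarith)
  have hsmall : ∀ᶠ k : ℕ in atTop, 2 * reg₁.a k ≤ 2 * R₂ - ρ := by
    have h2 : Tendsto (fun k => 2 * reg₁.a k) atTop (𝓝 0) := by simpa using reg₁.tendsto_a.const_mul 2
    exact h2.eventually (ge_mem_nhds (by linarith))
  obtain ⟨k, hk₁, hk₂, hk₃⟩ := ((hlo M₁ hM₁).and ((hup M₂ hM₂).and hsmall)).exists
  obtain ⟨S, hS₁, hS₂⟩ := exists_odd_side_between (reg₁.a_pos k) hρpos hk₃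
  have hS₁' : R₁ ≤ reg₁.a k * (2 * (S : ℝ) + 1) := (le_max_left _ _).trans hS₁
  have hS₂' : R₂ ≤ reg₂.a k * (2 * (S : ℝ) + 1) := by rw [ha]; exact (le_max_right _ _).trans hS₁
  have hS₃' : reg₂.a k * (2 * (S : ℝ) + 1) ≤ 2 * R₂ := by rw [ha]; exact hS₂
  have h1 := hk₁ S hS₁'
  have h2 := hk₂ S hS₂' hS₃'
  simp only [hw, hμ, hβ] at h2
  simp only at h1
  linarith

/-- **A germ strictly below `−M₀` is excluded — modulo radius compatibility.**  If `reg` carries the threshold LOWER pin at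
the tuple `J + m'` with radius `R` and the re-centring `upShift reg J`, `J < −M₀`, carries a zero-threshold UPPER pin at the
positive tuple `m'` with radius `R'`, then `R < 2R'` is contradictory: depth `M := (M₀ − J)/2 > M₀` of `reg` and height
`M' := (−M₀ − J)/2 > 0` of the re-centring are the same bare mass. [folklore] -/
theorem germ_not_below_of_compatible {reg : QCDRegularisation Nf} {M₀ J : ℝ} (hJ : J < -M₀) {m' : Fin Nf → ℝ} {R R' : ℝ}
    (hlo : PinClause Nf reg M₀ (fun f => J + m' f) R) (hup : UpperPin Nf (upShift reg J) 0 m' R') (hR' : 0 < R')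
    (hRR' : R < 2 * R') : False := by
  refine pin_clash (M₁ := (M₀ - J) / 2) (M₂ := (-M₀ - J) / 2) hlo hup (fun k => rfl) (fun k => rfl)
    (fun k f => ?_) (by linarith) (by linarith) (fun k => ?_) hR' hRR'
  · simp only [upShift_mcrit, upShift_a, upShift_Zm]
    ring
  · simp only [upShift_mcrit, upShift_a, upShift_Zm]
    ring

/-- **A germ strictly above `M₀` is excluded — modulo radius compatibility.**  If `reg` carries the threshold UPPER pin at the
tuple `J + m'` with radius `R` and the re-centring `upShift reg J`, `M₀ < J`, carries a zero-threshold LOWER pin at the positive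
tuple `m'` with radius `R'`, then `R' < 2R` is contradictory: height `M := (J + M₀)/2 > M₀` of `reg` and depth
`M' := (J − M₀)/2 > 0` of the re-centring are the same bare mass. [folklore] -/
theorem germ_not_above_of_compatible {reg : QCDRegularisation Nf} {M₀ J : ℝ} (hJ : M₀ < J) {m' : Fin Nf → ℝ} {R R' : ℝ}
    (hup : UpperPin Nf reg M₀ (fun f => J + m' f) R) (hlo : PinClause Nf (upShift reg J) 0 m' R') (hR : 0 < R)
    (hRR' : R' < 2 * R) : False := by
  refine pin_clash (M₁ := (J - M₀) / 2) (M₂ := (J + M₀) / 2) hlo hup (fun k => rfl) (fun k => rfl)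
    (fun k f => ?_) (by linarith) (by linarith) (fun k => ?_) hR hRR'
  · simp only [upShift_mcrit, upShift_a, upShift_Zm]
    ring
  · simp only [upShift_mcrit, upShift_a, upShift_Zm]
    ring

/-- **The zero-threshold germ is unique — modulo radius compatibility.**  Two re-centrings `upShift reg J₁`, `upShift reg J₂`
with `J₁ < J₂`, the higher one carrying a zero-threshold LOWER pin at the positive tuple `m₂` with radius `R₂` and the lower one a
zero-threshold UPPER pin at the tuple `m₁ = (J₂ − J₁) + m₂` with radius `R₁`, clash as soon as `R₂ < 2R₁`: depth and height
`(J₂ − J₁)/2 > 0` are the same bare mass. [folklore] -/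
theorem zeroGerm_unique_of_compatible {reg : QCDRegularisation Nf} {J₁ J₂ : ℝ} (hJ : J₁ < J₂) {m₂ : Fin Nf → ℝ} {R₁ R₂ : ℝ}
    (hlo : PinClause Nf (upShift reg J₂) 0 m₂ R₂) (hup : UpperPin Nf (upShift reg J₁) 0 (fun f => (J₂ - J₁) + m₂ f) R₁)
    (hR₁ : 0 < R₁) (hRR : R₂ < 2 * R₁) : False := by
  refine pin_clash (M₁ := (J₂ - J₁) / 2) (M₂ := (J₂ - J₁) / 2) hlo hup (fun k => rfl) (fun k => rfl)
    (fun k f => ?_) (by linarith) (by linarith) (fun k => ?_) hR₁ hRR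
  · simp only [upShift_mcrit, upShift_a, upShift_Zm]
    ring
  · simp only [upShift_mcrit, upShift_a, upShift_Zm]
    ring

/-- **Inside ONE package the clash never fires**: the lower-pin masses `m_crit − a M/Z_m` (`M > M₀ ≥ 0`) and the upper-pin
masses `m_crit + a M'/Z_m` (`M' > M₀`) of the same regularisation are always distinct (indeed ordered), so a single two-sided
pin package is consistent with respect to this mechanism whatever its radius; the clash is a statement about TWO pinning
coordinates. [folklore] -/
theorem lowerPinMass_lt_upperPinMass (reg : QCDRegularisation Nf) {M₀ M M' : ℝ} (hM₀ : 0 ≤ M₀) (hM : M₀ < M)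
    (hM' : M₀ < M') (k : ℕ) :
    reg.mcrit k - reg.a k * M / reg.Zm k < reg.mcrit k + reg.a k * M' / reg.Zm k := by
  have ha := reg.a_pos k
  have hZ := reg.Zm_pos k
  have h1 : 0 < reg.a k * M / reg.Zm k := by
    apply div_pos (mul_pos ha (by linarith)) hZ
  have h2 : 0 < reg.a k * M' / reg.Zm k := by
    apply div_pos (mul_pos ha (by linarith)) hZ
  linarith

/-! ## §8.4 With an upper pin quantified over ALL radii, rigidity becomes unconditional

The physically expected form of the upper pin is "for EVERY radius `R ≥ R₀` (and every height `M > M₀`), eventually in `k`, on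
odd tori of side in `[R, 2R]` the ratio is `≤ 1/8`" (`k` after `R`: at fixed `R` the early-crosser count on tori of side `≤ 2R`
vanishes as `k → ∞`).  Under that form the radius compatibility of §8.3 is AUTOMATIC (take `R := max R₀ R_lower`), so the germ
confinement and uniqueness statements hold outright.  This is the precise sense in which the crux's `∃ R` (one radius shared by
the lower and the upper pin of a package) is what keeps rigidity from being a theorem. -/

/-- **Germ below `−M₀` excluded outright when the re-centring's upper pin holds at all radii `≥ R₀`.** [folklore] -/
theorem germ_not_below_of_allRadii {reg : QCDRegularisation Nf} {M₀ J : ℝ} (hJ : J < -M₀) {m' : Fin Nf → ℝ} {R R₀ : ℝ}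
    (hlo : PinClause Nf reg M₀ (fun f => J + m' f) R) (hR₀ : 0 < R₀)
    (hup : ∀ R', R₀ ≤ R' → UpperPin Nf (upShift reg J) 0 m' R') : False :=
  germ_not_below_of_compatible hJ hlo (hup (max R₀ R) (le_max_left _ _)) (lt_max_of_lt_left hR₀)
    (by have := le_max_right R₀ R; have := le_max_left R₀ R; linarith)

/-- **Germ above `M₀` excluded outright when the threshold upper pin of `reg` holds at all radii `≥ R₀`.** [folklore] -/
theorem germ_not_above_of_allRadii {reg : QCDRegularisation Nf} {M₀ J : ℝ} (hJ : M₀ < J) {m' : Fin Nf → ℝ} {R' R₀ : ℝ}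
    (hup : ∀ R, R₀ ≤ R → UpperPin Nf reg M₀ (fun f => J + m' f) R) (hlo : PinClause Nf (upShift reg J) 0 m' R')
    (hR₀ : 0 < R₀) : False :=
  germ_not_above_of_compatible hJ (hup (max R₀ R') (le_max_left _ _)) hlo (lt_max_of_lt_left hR₀)
    (by have := le_max_right R₀ R'; have := le_max_left R₀ R'; linarith)

/-- **Zero-threshold germ unique outright when upper pins hold at all radii `≥ R₀`.** [folklore] -/
theorem zeroGerm_unique_of_allRadii {reg : QCDRegularisation Nf} {J₁ J₂ : ℝ} (hJ : J₁ < J₂) {m₂ : Fin Nf → ℝ} {R₂ R₀ : ℝ}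
    (hlo : PinClause Nf (upShift reg J₂) 0 m₂ R₂) (hR₀ : 0 < R₀)
    (hup : ∀ R₁, R₀ ≤ R₁ → UpperPin Nf (upShift reg J₁) 0 (fun f => (J₂ - J₁) + m₂ f) R₁) : False :=
  zeroGerm_unique_of_compatible hJ hlo (hup (max R₀ R₂) (le_max_left _ _)) (lt_max_of_lt_left hR₀)
    (by have := le_max_right R₀ R₂; have := le_max_left R₀ R₂; linarith)

/-! ## §9 The crux is a SELF-IMPROVEMENT statement; stub J is a non-existence statement (cycle 2)

`Concl Nf` is itself an instance of the hypothesis package at threshold `0` (the weak branch follows from `m_crit' → 0`), so the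
crux reads: "if the package `HypAt` is inhabited at SOME threshold, it is inhabited at threshold `0` by a regularisation that is
moreover on the physical branch and chiral at zero" (`lightQuarkCompletion_iff_selfImprovement`); and it is implied outright by
"`Concl` holds at `N_f = 2, 3`" (`lightQuarkCompletion_of_concl`) — the hypotheses serve only as an EXISTENCE ASSUMPTION, the
whole content being the passage threshold `M₀ ↦ 0` + branch + chirality.  Dually, stub J says EXACTLY that no
zero-threshold-pinned all-masses regularisation has a uniform gap rate (`stubJumpLineIsChiral_iff_not_exists`). -/

/-- `Concl` inhabits the hypothesis package at threshold `0`, on the branch and chiral. -/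
theorem hypAt_zero_of_concl (h : Concl Nf) :
    ∃ reg : QCDRegularisation Nf, HypAt Nf reg 0 ∧ Tendsto reg.mcrit atTop (𝓝 0) ∧ reg.IsChiralAtZero := by
  obtain ⟨reg', hMS, hAS, hlim, hpin, hχ, hbody⟩ := h
  have hbr : ∀ᶠ k : ℕ in atTop, -1 ≤ reg'.mcrit k := by
    filter_upwards [hlim.eventually (Ioi_mem_nhds (show (-1 : ℝ) < 0 by norm_num))] with k hk
    exact (Set.mem_Ioi.mp hk).le
  exact ⟨reg', ⟨hMS, hAS, hbr, le_rfl, hpin, hbody⟩, hlim, hχ⟩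

/-- `Concl Nf` ⇔ the package is inhabited at threshold `0` by a branch regularisation chiral at zero. -/
theorem concl_iff_hypAt_zero :
    Concl Nf ↔ ∃ reg : QCDRegularisation Nf, HypAt Nf reg 0 ∧ Tendsto reg.mcrit atTop (𝓝 0) ∧ reg.IsChiralAtZero := by
  refine ⟨hypAt_zero_of_concl, ?_⟩
  rintro ⟨reg, ⟨hMS, hAS, -, -, hpin, hbody⟩, hlim, hχ⟩
  exact ⟨reg, hMS, hAS, hlim, hpin, hχ, hbody⟩

/-- **The crux as self-improvement of the package**: inhabited at some threshold ⇒ inhabited at threshold `0`, on the branch,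
chiral at zero. -/
theorem lightQuarkCompletion_iff_selfImprovement :
    LightQuarkCompletion ↔ ∀ Nf : ℕ, (Nf = 2 ∨ Nf = 3) → (∃ (reg : QCDRegularisation Nf) (M₀ : ℝ), HypAt Nf reg M₀) →
      ∃ reg : QCDRegularisation Nf, HypAt Nf reg 0 ∧ Tendsto reg.mcrit atTop (𝓝 0) ∧ reg.IsChiralAtZero := by
  rw [lightQuarkCompletion_iff_exists]
  refine forall_congr' fun Nf => forall_congr' fun _ => forall_congr' fun _ => ?_
  exact concl_iff_hypAt_zero

/-- **The hypotheses are an existence assumption only**: `Concl` at `N_f = 2, 3` implies the crux outright. -/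
theorem lightQuarkCompletion_of_concl (h : ∀ Nf : ℕ, (Nf = 2 ∨ Nf = 3) → Concl Nf) : LightQuarkCompletion :=
  lightQuarkCompletion_iff_exists.mpr fun Nf hNf _ => h Nf hNf

/-- **Uniformly gapped, zero-threshold-pinned, all-masses QCD at `N_f`** — the object whose NON-existence stub J asserts.
Statement abbreviation (believed EMPTY for `N_f ≥ 2` — Goldstone; believed INHABITED for `N_f = 1` if pinned one-flavour QCD
exists, which is why J needs a flavour input). [topic constructive-qft] -/
def UniformlyGappedZeroPinnedQCD (Nf : ℕ) : Prop :=
  ∃ reg' : QCDRegularisation Nf, reg'.HasMassScaling ∧ (reg'.scheme 0 0 0).HasAsymptoticScaling ∧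
    Tendsto reg'.mcrit atTop (𝓝 0) ∧ PinPkg Nf reg' 0 ∧ Body Nf reg' 0 ∧
      ∃ ε > (0 : ℝ), ∀ m : Fin Nf → ℝ, (∀ f, 0 < m f) → (reg'.scheme m 0 0).HasLatticeMassGap ε

/-- **Stub J is EXACTLY a non-existence statement**: J ⇔ for `N_f ∈ {2,3}` no uniformly gapped zero-threshold-pinned
all-masses QCD exists.  A proof of J must turn pin + body into gaplessness as `m → 0⁺`; a disproof must CONSTRUCT the pinned
object with a uniform gap (and §4: without the pin such objects exist modulo H). -/
theorem stubJumpLineIsChiral_iff_not_exists :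
    StubJumpLineIsChiral ↔ ∀ Nf : ℕ, (Nf = 2 ∨ Nf = 3) → ¬ UniformlyGappedZeroPinnedQCD Nf := by
  rw [stubJumpLineIsChiral_iff]
  constructor
  · rintro h Nf hNf ⟨reg', hMS, hAS, hlim, hpin, hbody, ε, hε, hgap⟩
    obtain ⟨m, hm, hno⟩ := h Nf hNf reg' hMS hAS hlim hpin hbody ε hε
    exact hno (hgap m hm)
  · intro h Nf hNf reg' hMS hAS hlim hpin hbody
    by_contra hχ
    refine h Nf hNf ⟨reg', hMS, hAS, hlim, hpin, hbody, ?_⟩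
    simp only [QCDRegularisation.IsChiralAtZero, not_forall, not_exists, not_and, not_not] at hχ
    obtain ⟨ε, hε, hall⟩ := hχ
    exact ⟨ε, hε, fun m hm => hall m hm⟩


/-! ## §11 Line `Sketch` — stub B2c (`stub_lightBody`): answer to the lead's `disprover-wanted` (cycle 2)

**Q** (lead c1, crux NOTES.md HANDOFF): is B2c in its SAME-reg pinned form — the body of `reg` at the tuples `J + m`, `m > 0`,
some `J + m_f ≤ M₀` — refutable modulo a believed-true `H` (e.g. light trajectories of a threshold regularisation running into an
Aoki / first-order artefact at fixed RGI mass), i.e. is the `∀ reg` same-data continuation misstated where the `∃ reg` form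
(`QuarksAsStableAction.ChiralCompletion`, stmt-17394) is not?

**A: no believable `H` kills it; one clause is needlessly strong and can be weakened for free.**
(i) PHYSICS.  Aoki fingers / first-order metastability bands around the critical line have bare width `O(a³)` resp. `O(a²)`
(lattice units; Sharpe–Singleton 1998, the tree's `AokiPhaseDichotomy`), i.e. RGI width `→ 0`; so at every FIXED positive RGI
tuple the trajectory `m_crit' + a_k m/Z_m` is eventually (in `k`) outside them — PROVIDED `m_crit'` is the chiral line to
`o(a_k/Z_m)`, which is exactly stub J's content.  If instead the parity-jump line sat an RGI distance `D > 0` BELOW the chiral line,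
same-reg B2c would indeed fail (for `N_f = 3` the tuples in `(0, D)·1` realise `θ = π` QCD — Dashen phase, degenerate vacua, no
clustering OS data; for `N_f = 2` they realise negative-mass QCD through the supercritical Wilson region) — but then J and `Concl`
fail as well: that is the SUBSTANTIVE failure mode of the whole crux (route kill criterion (iv′)), not a misstatement of B2c, and
it is not "believed true".  No other artefact at fixed RGI mass is known.
(ii) LOGIC.  The one formal excess of same-reg B2c over the `∃ reg` form is FULL-SEQUENCE CONVERGENCE: `IsQCDAlong` along `reg`'s
OWN sequence at every light tuple (uniqueness of the limit along that sequence — human ruling Y2 deliberately asks existence along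
A sequence only), with no subsequence freedom, whereas the hypothesis certifies that sequence only above `M₀`.  Not refutable
modulo anything believed (non-uniqueness of the continuum limit is not believed; and the hypothesis itself already asserts
full-sequence convergence at uncountably many tuples), but needlessly strong: `lightQuarkCompletion_of_stubs_subseqBody` below
shows that B2c WEAKENED to "the body along SOME further subsequence `ψ`" still closes the crux with B2a, B2b, J unchanged (pins,
scalings and `m_crit' → 0` are hereditary, J is `∀ reg'`).  RECOMMENDED RESHAPE of `stub_lightBody`: conclusion
`∃ (ψ : ℕ → ℕ) (hψ : StrictMono ψ), ∀ m > 0, body of (re-centred reg).restrict ψ at m`.  (Over the abbreviations below,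
`upShift r J` is definitionally the skeleton's `QCDRegularisation.mk r.a … (fun k => r.mcrit k + r.a k * J / r.Zm k) r.Zm r.Zm_pos`
and `PinPkg`/`Body` unfold to the registered clause texts, so the statement transfers to the registered signatures by `Iff.rfl`.) -/

open Summit.QuantumFields.QCD.Theorems in
/-- **Weakened B2c suffices**: with B2a (germ along a subsequence), B2b (branch) and J as registered (here over the
abbreviations), the light body along SOME further subsequence of the re-centred regularisation already yields the crux — the
witness is `((reg.restrict φ) re-centred at J).restrict ψ`. -/
theorem lightQuarkCompletion_of_stubs_subseqBody
    (hGerm : ∀ Nf : ℕ, (Nf = 2 ∨ Nf = 3) → ∀ (reg : QCDRegularisation Nf) (M₀ : ℝ), HypAt Nf reg M₀ →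
      ∃ (φ : ℕ → ℕ) (hφ : StrictMono φ) (J : ℝ), PinPkg Nf (upShift (reg.restrict φ hφ.tendsto_atTop) J) 0)
    (hBranch : ∀ Nf : ℕ, (Nf = 2 ∨ Nf = 3) → ∀ (reg : QCDRegularisation Nf) (M₀ : ℝ), HypAt Nf reg M₀ →
      ∀ J : ℝ, PinPkg Nf (upShift reg J) 0 → Tendsto reg.mcrit atTop (𝓝 0))
    (hLight : ∀ Nf : ℕ, (Nf = 2 ∨ Nf = 3) → ∀ (reg : QCDRegularisation Nf) (M₀ : ℝ), HypAt Nf reg M₀ →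
      ∀ J : ℝ, PinPkg Nf (upShift reg J) 0 →
        ∃ (ψ : ℕ → ℕ) (hψ : StrictMono ψ), Body Nf ((upShift reg J).restrict ψ hψ.tendsto_atTop) 0)
    (hChiral : StubJumpLineIsChiral) : LightQuarkCompletion := by
  rw [lightQuarkCompletion_iff]
  rintro Nf hNf reg M₀ ⟨hMS, hAS, hbr, hM₀, hpin, hbody⟩
  have hNf16 : Nf ≤ 16 := by rcases hNf with rfl | rfl <;> norm_num
  -- (B2a) subsequence and germ
  obtain ⟨φ, hφ, J, hpin'⟩ := hGerm Nf hNf reg M₀ ⟨hMS, hAS, hbr, hM₀, hpin, hbody⟩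
  set r : QCDRegularisation Nf := reg.restrict φ hφ.tendsto_atTop with hr
  -- the package passes to the subsequence
  have hMSr : r.HasMassScaling := StronglyChiralSubsequence.hasMassScaling_restrict reg φ hφ hMS
  have hASr : (r.scheme 0 0 0).HasAsymptoticScaling := StronglyChiralSubsequence.hasAsymptoticScaling_restrict reg φ hφ hAS
  have hbrr : ∀ᶠ k : ℕ in atTop, -1 ≤ r.mcrit k := LightQuarkJumpLine.branch_restrict reg φ hφ hbr
  have hpinr : PinPkg Nf r M₀ := LightQuarkJumpLine.pin_restrict reg φ hφ hpin
  have hbodyr : Body Nf r M₀ := LightQuarkJumpLine.body_restrict reg φ hφ hbody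
  have hHr : HypAt Nf r M₀ := ⟨hMSr, hASr, hbrr, hM₀, hpinr, hbodyr⟩
  -- (B2b) the branch along the subsequence; (B2c') the light body along a further subsequence
  have hlimr : Tendsto r.mcrit atTop (𝓝 0) := hBranch Nf hNf r M₀ hHr J hpin'
  obtain ⟨ψ, hψ, hbody'⟩ := hLight Nf hNf r M₀ hHr J hpin'
  -- the witness: the re-centred `r`, restricted along `ψ`
  set u : QCDRegularisation Nf := upShift r J with hu
  have hMSu : u.HasMassScaling := (hasMassScaling_upShift r J).mpr hMSr
  have hASu : (u.scheme 0 0 0).HasAsymptoticScaling := (hasAsymptoticScaling_upShift r J).mpr hASr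
  have hlimu : Tendsto u.mcrit atTop (𝓝 0) := tendsto_mcrit_upShift r J hNf16 hMSr hlimr
  refine ⟨u.restrict ψ hψ.tendsto_atTop, StronglyChiralSubsequence.hasMassScaling_restrict u ψ hψ hMSu,
    StronglyChiralSubsequence.hasAsymptoticScaling_restrict u ψ hψ hASu, hlimu.comp hψ.tendsto_atTop,
    LightQuarkJumpLine.pin_restrict u ψ hψ hpin', ?_, hbody'⟩
  -- (J) chirality of the witness
  exact (stubJumpLineIsChiral_iff.mp hChiral) Nf hNf _ (StronglyChiralSubsequence.hasMassScaling_restrict u ψ hψ hMSu)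
    (StronglyChiralSubsequence.hasAsymptoticScaling_restrict u ψ hψ hASu) (hlimu.comp hψ.tendsto_atTop)
    (LightQuarkJumpLine.pin_restrict u ψ hψ hpin') hbody'


/-! ## §12 The flavour guard `N_f ∈ {2,3}` is load-bearing: at `N_f = 0` the conclusion is INCONSISTENT (cycle 2)

At `N_f = 0` there is exactly ONE mass tuple (`Fin 0 → ℝ` is a subsingleton).  The body at every (= the) tuple gives a lattice
gap rate `Δ > 0` there, while `IsChiralAtZero` asks, for `ε := Δ`, a tuple WITHOUT gap `Δ` — the same tuple.  Hence
`Body 0 reg M₀ → ¬ reg.IsChiralAtZero` and `¬ Concl 0` OUTRIGHT; so the crux resp. stub J with the guard `Nf = 2 ∨ Nf = 3`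
deleted are FALSE as soon as the quenched threshold package (resp. the zero-pinned quenched package) is inhabited — two-sided
pinned, gapped SU(3) lattice Yang–Mills with OS limit: believed TRUE, not constructible here.  Any proof of J and of the crux must
USE `N_f ≥ 2` in Lean, not only in physics (where `N_f = 1`, no Goldstone boson, is the sharper reason — but at `N_f = 1` the
tuples no longer coincide and nothing is provable here); the flavour input of card `anomaly-at-the-pinned-corner` is not optional.
Landed as `Theorems/LightQuarkCompletion/Negative/FlavourRestriction.lean` (cycle 2 proposal). -/

/-- At `N_f = 0` all mass tuples coincide. [folklore] -/
theorem tuple_eq_of_zeroFlavour (m m' : Fin 0 → ℝ) : m = m' :=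
  funext fun f => f.elim0

/-- The lattice gap clause does not read the species renormalisations `(z, shift)`. [folklore] -/
theorem hasLatticeMassGap_scheme_irrel (reg : QCDRegularisation Nf) (m : Fin Nf → ℝ)
    (z shift z' shift' : QCDField Nf → ℕ → ℝ) (Δ : ℝ) :
    (reg.scheme m z shift).HasLatticeMassGap Δ ↔ (reg.scheme m z' shift').HasLatticeMassGap Δ :=
  Iff.rfl

/-- **At `N_f = 0` the body excludes chirality at zero.** [folklore] -/
theorem not_isChiralAtZero_of_body_zeroFlavour {reg : QCDRegularisation 0} {M₀ : ℝ} (h : Body 0 reg M₀) :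
    ¬ reg.IsChiralAtZero := by
  intro hχ
  obtain ⟨z, shift, T, -, -, -, -, Δ, hΔ, -, hgap⟩ := h (fun f => f.elim0) (fun f => f.elim0)
  obtain ⟨m, -, hno⟩ := hχ Δ hΔ
  apply hno
  rw [tuple_eq_of_zeroFlavour m (fun f => f.elim0)]
  exact (hasLatticeMassGap_scheme_irrel reg _ z shift 0 0 Δ).mp hgap

/-- **`¬ Concl 0`**: the conclusion shape of the crux is inconsistent in the quenched theory. [folklore] -/
theorem not_concl_zero : ¬ Concl 0 := by
  rintro ⟨reg', -, -, -, -, hχ, hbody⟩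
  exact not_isChiralAtZero_of_body_zeroFlavour hbody hχ

/-- **The crux with the flavour guard DELETED.**  Statement abbreviation; FALSE modulo `QuenchedThresholdPackage`. -/
def LightQuarkCompletionAllFlavours : Prop :=
  ∀ (Nf : ℕ) (reg : QCDRegularisation Nf) (M₀ : ℝ), HypAt Nf reg M₀ → Concl Nf

/-- **H₀ — the quenched threshold package is inhabited** (two-sided-pinned, gapped SU(3) lattice Yang–Mills with OS limit and
non-trivial non-Gaussian glue along an asymptotically scaling, mass-scaling sequence).  Believed TRUE; not constructible here.
[topic constructive-qft] -/
def QuenchedThresholdPackage : Prop :=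
  ∃ (reg : QCDRegularisation 0) (M₀ : ℝ), HypAt 0 reg M₀

/-- **The flavour guard is load-bearing in the crux (modulo H₀).** [folklore] -/
theorem lightQuarkCompletionAllFlavours_false_of (H : QuenchedThresholdPackage) : ¬ LightQuarkCompletionAllFlavours := by
  intro h
  obtain ⟨reg, M₀, hH⟩ := H
  exact not_concl_zero (h 0 reg M₀ hH)

/-- **Stub J with the flavour guard DELETED** (over the abbreviations).  Statement abbreviation; FALSE modulo
`ZeroPinnedQuenchedPackage`. -/
def StubJumpLineIsChiralAllFlavours : Prop :=
  ∀ (Nf : ℕ) (reg' : QCDRegularisation Nf), reg'.HasMassScaling → (reg'.scheme 0 0 0).HasAsymptoticScaling →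
    Tendsto reg'.mcrit atTop (𝓝 0) → PinPkg Nf reg' 0 → Body Nf reg' 0 → reg'.IsChiralAtZero

/-- **H₀′ — the zero-threshold-pinned quenched package is inhabited.**  Believed TRUE; not constructible here.
[topic constructive-qft] -/
def ZeroPinnedQuenchedPackage : Prop :=
  ∃ reg' : QCDRegularisation 0, reg'.HasMassScaling ∧ (reg'.scheme 0 0 0).HasAsymptoticScaling ∧
    Tendsto reg'.mcrit atTop (𝓝 0) ∧ PinPkg 0 reg' 0 ∧ Body 0 reg' 0

/-- **The flavour guard is load-bearing in stub J (modulo H₀′).** [folklore] -/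
theorem stubJumpLineIsChiralAllFlavours_false_of (H : ZeroPinnedQuenchedPackage) : ¬ StubJumpLineIsChiralAllFlavours := by
  intro h
  obtain ⟨reg', hMS, hAS, hlim, hpin, hbody⟩ := H
  exact not_isChiralAtZero_of_body_zeroFlavour hbody (h 0 reg' hMS hAS hlim hpin hbody)


/-! ## §13 Targets — the lead's stuck goal for B2a: the "lower pin THROUGH the band" residual is false for zero-pinned
## regularisations (cycle 2)

TARGET (lead c1, crux NOTES `## Census`, stuck goal of `stub_jumpGerm` through `LightQuarkJumpLine.jumpGerm_of_bandLowerPin`,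
`φ = id`, `J = M₀`): `⊢ ∀ m > M₀·1, ∃ R > 0, PinClause Nf reg (−M₀) m R ∧ UpperPin Nf reg M₀ m R` — the lower pin of the
threshold regularisation continued THROUGH the band up to height `M₀` ABOVE its line, i.e. the germ postulated at the TOP of the
band.  But the germ is a datum of `reg` anywhere in `[−M₀, M₀]`; whenever the jump line of `reg` sits strictly below the top —
e.g. `reg` already pinned at zero threshold (`J = 0`; by monotonicity a legitimate threshold-`M₀` package, and physically the shape
of the bridge's / the crux's own output) — the band lower pin asks `P ≥ 1/4` at heights in `(0, M₀)` where the zero-threshold UPPER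
pin gives `P ≤ 1/8`: `bandLowerPin_clash` (radius compatibility `R < 2R₀`), `not_bandLowerPin_of_allRadii` (all-radii upper pin:
every radius fails), `bandLowerPinResidual_false_of` (the residual over ALL threshold packages is FALSE modulo `ZeroPinnedAllRadii`,
one zero-threshold package with all-radii upper pins — believed TRUE).  Moral: the germ must be LOCATED (`J = J(reg)`, band
sharpening), not postulated; the `J = M₀` reduction is a dead end in general.  Landed as `…/Negative/BandLowerPin.lean` (cycle 2). -/

/-- **The band lower pin clashes with the zero-threshold upper pin of the same regularisation** (`R < 2R₀`): depth `−M₀/2` of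
the band lower pin and height `M₀/2` of the upper pin are the same bare mass, with the same weights. [folklore] -/
theorem bandLowerPin_clash {reg : QCDRegularisation Nf} {M₀ : ℝ} (hM₀ : 0 < M₀) {m : Fin Nf → ℝ} {R R₀ : ℝ}
    (hup : UpperPin Nf reg 0 m R₀) (hlo : PinClause Nf reg (-M₀) m R) (hR₀ : 0 < R₀) (hRR : R < 2 * R₀) : False :=
  pin_clash (M₁ := -M₀ / 2) (M₂ := M₀ / 2) hlo hup (fun _ => rfl) (fun _ => rfl) (fun _ _ => rfl) (by linarith)
    (by linarith) (fun k => by ring) hR₀ hRR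

/-- **With an all-radii zero-threshold upper pin the band lower pin fails at every radius.** [folklore] -/
theorem not_bandLowerPin_of_allRadii {reg : QCDRegularisation Nf} {M₀ : ℝ} (hM₀ : 0 < M₀) {m : Fin Nf → ℝ} {R₀ : ℝ}
    (hR₀ : 0 < R₀) (hup : ∀ R', R₀ ≤ R' → UpperPin Nf reg 0 m R') (R : ℝ) : ¬ PinClause Nf reg (-M₀) m R := fun hlo =>
  bandLowerPin_clash hM₀ (hup (max R₀ R) (le_max_left _ _)) hlo (lt_max_of_lt_left hR₀)
    (by have := le_max_right R₀ R; have := le_max_left R₀ R; linarith)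

/-- **The lead's residual for B2a through `J = M₀`, universally over threshold-`M₀` packages.**  Statement abbreviation;
FALSE modulo `ZeroPinnedAllRadii`. -/
def BandLowerPinResidual (Nf : ℕ) (M₀ : ℝ) : Prop :=
  ∀ reg : QCDRegularisation Nf, HypAt Nf reg M₀ → ∀ m : Fin Nf → ℝ, (∀ f, M₀ < m f) →
    ∃ R : ℝ, 0 < R ∧ PinClause Nf reg (-M₀) m R ∧ UpperPin Nf reg M₀ m R

/-- **H — a zero-threshold package whose upper pin holds at all radii** (the physically expected form of the crux's own
conclusion).  Believed TRUE; not constructible here. [topic constructive-qft] -/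
def ZeroPinnedAllRadii (Nf : ℕ) : Prop :=
  ∃ reg' : QCDRegularisation Nf, HypAt Nf reg' 0 ∧
    ∀ m : Fin Nf → ℝ, (∀ f, 0 < m f) → ∃ R₀ : ℝ, 0 < R₀ ∧ ∀ R', R₀ ≤ R' → UpperPin Nf reg' 0 m R'

/-- **The `J = M₀` route to B2a is dead (modulo H).** [folklore] -/
theorem bandLowerPinResidual_false_of {M₀ : ℝ} (hM₀ : 0 < M₀) (H : ZeroPinnedAllRadii Nf) :
    ¬ BandLowerPinResidual Nf M₀ := by
  intro h
  obtain ⟨reg', ⟨hMS, hAS, hbr, -, hpin, hbody⟩, hall⟩ := H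
  have hH : HypAt Nf reg' M₀ := ⟨hMS, hAS, hbr, hM₀.le, pinPkg_mono hpin hM₀.le, body_mono hbody hM₀.le⟩
  obtain ⟨R, -, hlo, -⟩ := h reg' hH (fun _ => M₀ + 1) (fun _ => by linarith)
  obtain ⟨R₀, hR₀, hup⟩ := hall (fun _ => M₀ + 1) (fun _ => by linarith)
  exact not_bandLowerPin_of_allRadii hM₀ hR₀ hup R hlo

/-! ## §10 Cycle 2 (refuter-cdisprove-stmt-QuantumFields-18066-g2-0, 2026-08-17): what was added, what was tried, why it
## still resists

* **Landed** under `Theorems/LightQuarkCompletion/Negative/` (all accepted): `Anatomy.lean` (cycle 1, §1–§3, p136772);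
  cycle 2: `LineSketchLoadBearing.lean` (§4, §5, §7, §9's J-form; p139458), `PinClash.lean` (§8; p139372), `SelfImprovement.lean`
  (§9; p139748), `FlavourRestriction.lean` (§12; p139863), `BandLowerPin.lean` (§13; p140088).  Provers may import them.
* **Re-examined, still no window.**  (i) Typed inconsistency of `Concl`: none — the zero-threshold lower pin only forces
  `m_crit'(k) < a_k M/Z_m(k)` eventually for each `M > 0` (compatible with `m_crit' → 0⁻`), the upper pin on `[R, 2R]` and the
  lower pin on `[R, ∞)` of ONE package never share a bare mass (`lowerPinMass_lt_upperPinMass`), the pin's small physical tori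
  (side `∼ R`) and the body's large tori (`S ≥ L_k`, `a_k L_k → ∞`) are disjoint regimes, and `IsChiralAtZero` (one gapless tuple
  per rate) is compatible with `Δ(m) > 0` at every tuple.  (ii) Junk inhabitant of the hypotheses: none — `(z, shift)` freedom
  can fake `T.schwinger` limits but not `HasLatticeMassGap` (reads only `β_k, m_f(k), L_k, a_k`: honest clustering at
  asymptotically free `β_k → ∞`), and `IsNontrivial glue` excludes the vacuum.  (iii) `N_f ∉ {2,3}`: `Concl 0` is physically
  FALSE (pure Yang–Mills is gapped, so no `IsChiralAtZero` at `N_f = 0`) and `Concl 1` likewise (no Goldstone boson), while the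
  threshold package at `N_f = 0, 1` is as plausible as at `2, 3` — so the restriction `N_f ∈ {2,3}` IS load-bearing physically,
  but neither side is constructible in Lean.  (iv) Dilation covariance `(a, Λ, m, Δ, R) ↦ (λa, Λ/λ, m/λ, Δ/λ, λR)` (crux ≡ crux
  at `M₀ = 1`): true on paper; a Lean proof needs dilation of `OSData` (all OS axioms under pull-back), not in the tree — not
  attempted.
* **Literature read for the zero-threshold UPPER pin (b″ at every `M > 0`)**, the one clause of `Concl` with accessible
  numerics: Bardeen–Duncan–Eichten–Hockney–Thacker, PRD 57 (1998) 1633 (hep-lat/9705008) p. 7: at quenched `β = 5.9`,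
  `12³ × 24`, "about 10 to 15% of the configurations need to be corrected for visible poles" (real modes crossing ABOVE `κ_c`,
  i.e. early crossers at positive quark mass), "at higher `β` for fixed physical volume, a smaller percentage … should be
  affected" (asserted, not measured); p. 10: the clover term does not shrink the spread of real eigenvalues.  Unquenched, at the
  STRANGE mass only: Mohler–Schaefer 2020, `2%, 0.3%, 0.05%` at `β_W = 3.4, 3.55, 3.7` (route NUMBERS).  The pin needs, for EACH
  fixed RGI height `M > 0`, the early-crosser fraction above `m_crit + a_k M/Z_m` on tori of side `≤ 2R` to fall below `1/8` as
  `k → ∞` — i.e. the spread of crossing masses must vanish in RGI units (`spread · Z_m/a_k → 0`).  Not established in print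
  either way; no finite computation binds an `∀ᶠ k` clause.  Recorded as the crux's most exposed physical assumption (it is also
  EarlyCrosserLaw's (b″) read at `M₀ = 0`).
* **Natural repair noted (planner's call, not proposed)**: quantify the upper pin over all radii (`∀ R ≥ R₀ ∀ M > M₀ ∀ᶠ k`, sides in
  `[R, 2R]`) — physically equivalent, and it makes pin rigidity (§8) a theorem, which B2a/B2b informally rely on.
-/

end Summit.QuantumFields.QCD.Cruxes.LightQuarkCompletion.Disproof

end
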